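import Literature.NumberTheory.Sieve.CFSemigroupPowFamily
import HarnessLib

/-!
# The renewal theorem for even words with a modified threshold

Support file (all results proved) for the named fact
`Literature.NumberTheory.Sieve.MageeOhWinter2019_uniformCounting` (`CFSemigroupCounting.lean`).
The semigroup `Γ_A` consists of the products of an EVEN number of generators, and the comparison of
the Frobenius-norm count with the dynamical count ([MageeOhWinter2019, §3, Lemmas 12–14]) modifies
the threshold `denom(M_w, x) ≤ X` by a positive Lipschitz factor `Φ(M_w x)` (the cocycle relating
the hyperbolic displacement to the boundary distortion). This file proves the corresponding
renewal theorem ([MageeOhWinter2019, Prop. 17], main term, `q = 1`):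

* `cfLenCountT Θ G n X x = Σ_{w ∈ Aⁿ, denom(M_w,x) Φ(M_w x) ≤ X} Re G(M_w x)` and the even count
  `cfEvenCountT Θ G X x = Σ_m cfLenCountT Θ G (2m) X x` (finite sums, monotone, `O(X^{2δ})`);
* `integral_cfLenCountT`: `∫_0^∞ N_n(e^{u/2δ}) e^{-su} du = s^{-1} (L_{δs}ⁿ G_s)(x)`, `G_s = G Φ^{-2δs}`;
* `tsum_cfLOp_even_pow_apply`: `Σ_m (L^{2m} G)(x) = ½ ((1-L)^{-1} G)(x) + ½ ((1+L)^{-1} G)(x)`;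
* `cfEvenLaplace_eq`: the Laplace transform of the even count is
  `½ s^{-1} F_{G_s,x}(δs) + ½ s^{-1} ((1 + L_{δs})^{-1} G_s)(x)`;
* `cfEvenCountT_asymp`: **`N_even(X, x; G, Φ) X^{-2δ} → ½ ν(G Φ^{-2δ}) h(x)/(δ κ)`**.
  [cite: MageeOhWinter2019, Prop. 17]

## References

* M. Magee, H. Oh, D. Winter, J. reine angew. Math. 753 (2019) 89–135, §3, Prop. 17.
  [MageeOhWinter2019]
-/

noncomputable section

open Set Filter Metric MeasureTheory
open scoped Topology

namespace Literature.NumberTheory.Sieve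

variable {A : Finset ℕ}

/-! ### The threshold-modified counts -/

variable (A) in
/-- `N_n(X, x; G, Φ) = Σ_{w ∈ Aⁿ, denom(M_w, x) Φ(M_w x) ≤ X} Re G(M_w x)`. [cite: MageeOhWinter2019, §3] -/
def cfLenCountT (Θ : CfThreshold) (G : CfLip) (n : ℕ) (X x : ℝ) : ℝ :=
  ∑ w : Fin n → A, (G.extend (cfMoeb (cfMat fun i => (w i : ℕ)) x)).re *
    (if cfDenom (cfMat fun i => (w i : ℕ)) x * Θ.Φ (cfMoeb (cfMat fun i => (w i : ℕ)) x) ≤ X then (1 : ℝ) else 0)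

variable (A) in
/-- **The even count** `N_even(X, x; G, Φ) = Σ_m N_{2m}(X, x; G, Φ)` (words of even length, as in `Γ_A`).
[cite: MageeOhWinter2019, §3] -/
def cfEvenCountT (Θ : CfThreshold) (G : CfLip) (X x : ℝ) : ℝ := ∑' m, cfLenCountT A Θ G (2 * m) X x

section Counts

variable (Θ : CfThreshold) {G : CfLip}

/-- `N_n(·; G, Φ) ≥ 0` for `G ≥ 0`. [folklore] -/
theorem cfLenCountT_nonneg (hG0 : ∀ y : Icc (0 : ℝ) 1, 0 ≤ (G y).re) (n : ℕ) (X x : ℝ) :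
    0 ≤ cfLenCountT A Θ G n X x :=
  Finset.sum_nonneg fun _ _ => mul_nonneg (hG0 _) (by split_ifs <;> norm_num)

/-- `N_n(·; G, Φ)` is non-decreasing in `X`. [folklore] -/
theorem cfLenCountT_mono (hG0 : ∀ y : Icc (0 : ℝ) 1, 0 ≤ (G y).re) (n : ℕ) (x : ℝ) :
    Monotone fun X => cfLenCountT A Θ G n X x := by
  intro X X' hXX'
  refine Finset.sum_le_sum fun w _ => mul_le_mul_of_nonneg_left ?_ (hG0 _)
  by_cases h : cfDenom (cfMat fun i => (w i : ℕ)) x * Θ.Φ (cfMoeb (cfMat fun i => (w i : ℕ)) x) ≤ X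
  · rw [if_pos h, if_pos (h.trans hXX')]
  · rw [if_neg h]; split_ifs <;> norm_num

/-- The modified denominator dominates the plain one: `denom ≤ denom · Φ`. [folklore] -/
theorem cfDenom_le_mul_Φ (hA : ∀ a ∈ A, 1 ≤ a) {x : ℝ} (hx : x ∈ Icc (0 : ℝ) 1) {n : ℕ} (w : Fin n → A) :
    cfDenom (cfMat fun i => (w i : ℕ)) x ≤
      cfDenom (cfMat fun i => (w i : ℕ)) x * Θ.Φ (cfMoeb (cfMat fun i => (w i : ℕ)) x) :=
  le_mul_of_one_le_right (cfDenom_cfMat_pos (one_le_coe_digit hA w) hx).le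
    (Θ.one_le _ (cfMoeb_cfMat_mem (one_le_coe_digit hA w) hx))

/-- `N_n(X, x; G, Φ) = 0` if `2^N > X²` and `n > N`. [folklore] -/
theorem cfLenCountT_eq_zero (hA : ∀ a ∈ A, 1 ≤ a) (G : CfLip) {x : ℝ} (hx : x ∈ Icc (0 : ℝ) 1) {N : ℕ} {X : ℝ}
    (hX : X ^ 2 < (2 : ℝ) ^ N) {n : ℕ} (hn : N < n) : cfLenCountT A Θ G n X x = 0 :=
  Finset.sum_eq_zero fun w _ => by
    rw [if_neg (not_le.2 ((lt_cfDenom_of_long hA hx hX hn w).trans_le (cfDenom_le_mul_Φ Θ hA hx w))), mul_zero]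

/-- `N_n(X, x; G, Φ) ≤ ‖G‖ N_n(X, x)`. [folklore] -/
theorem cfLenCountT_le (hA : ∀ a ∈ A, 1 ≤ a) (G : CfLip) (n : ℕ) (X : ℝ) {x : ℝ} (hx : x ∈ Icc (0 : ℝ) 1) :
    cfLenCountT A Θ G n X x ≤ ‖G‖ * cfLenCount A n X x := by
  rw [cfLenCount, Finset.mul_sum]
  refine Finset.sum_le_sum fun w _ => ?_
  have hG : (G.extend (cfMoeb (cfMat fun i => (w i : ℕ)) x)).re ≤ ‖G‖ :=
    ((Complex.abs_re_le_norm _).trans (G.norm_extend_le _)).trans' (le_abs_self _)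
  by_cases h : cfDenom (cfMat fun i => (w i : ℕ)) x * Θ.Φ (cfMoeb (cfMat fun i => (w i : ℕ)) x) ≤ X
  · rw [if_pos h, if_pos ((cfDenom_le_mul_Φ Θ hA hx w).trans h)]
    linarith
  · rw [if_neg h, mul_zero]
    exact mul_nonneg (norm_nonneg G) (by split_ifs <;> norm_num)

/-- The even count is a finite sum for any cut-off with `2^N > X²`. [folklore] -/
theorem cfEvenCountT_eq_sum (hA : ∀ a ∈ A, 1 ≤ a) (G : CfLip) {x : ℝ} (hx : x ∈ Icc (0 : ℝ) 1) {N : ℕ} {X : ℝ}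
    (hX : X ^ 2 < (2 : ℝ) ^ N) :
    cfEvenCountT A Θ G X x = ∑ m ∈ Finset.range (N + 1), cfLenCountT A Θ G (2 * m) X x := by
  rw [cfEvenCountT, tsum_eq_sum]
  intro m hm
  rw [Finset.mem_range, not_lt] at hm
  exact cfLenCountT_eq_zero Θ hA G hx hX (by omega)

/-- `N_even ≥ 0`. [folklore] -/
theorem cfEvenCountT_nonneg (hG0 : ∀ y : Icc (0 : ℝ) 1, 0 ≤ (G y).re) (X x : ℝ) : 0 ≤ cfEvenCountT A Θ G X x :=
  tsum_nonneg fun m => cfLenCountT_nonneg Θ hG0 (2 * m) X x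

/-- `N_even` is non-decreasing in `X`. [folklore] -/
theorem cfEvenCountT_mono (hA : ∀ a ∈ A, 1 ≤ a) (hG0 : ∀ y : Icc (0 : ℝ) 1, 0 ≤ (G y).re) {x : ℝ}
    (hx : x ∈ Icc (0 : ℝ) 1) : Monotone fun X => cfEvenCountT A Θ G X x := by
  intro X X' h
  obtain ⟨N, hN⟩ := exists_pow_two_gt X
  obtain ⟨N', hN'⟩ := exists_pow_two_gt X'
  have h1 : X ^ 2 < (2 : ℝ) ^ max N N' := hN.trans_le (pow_le_pow_right₀ (by norm_num) (le_max_left _ _))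
  have h2 : X' ^ 2 < (2 : ℝ) ^ max N N' := hN'.trans_le (pow_le_pow_right₀ (by norm_num) (le_max_right _ _))
  show cfEvenCountT A Θ G X x ≤ cfEvenCountT A Θ G X' x
  rw [cfEvenCountT_eq_sum Θ hA G hx h1, cfEvenCountT_eq_sum Θ hA G hx h2]
  exact Finset.sum_le_sum fun m _ => cfLenCountT_mono Θ hG0 _ x h

/-- `N_even(X, x; G, Φ) ≤ ‖G‖ N(X, x)`. [folklore] -/
theorem cfEvenCountT_le_norm_mul (hA : ∀ a ∈ A, 1 ≤ a) (G : CfLip) {x : ℝ}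
    (hx : x ∈ Icc (0 : ℝ) 1) (X : ℝ) : cfEvenCountT A Θ G X x ≤ ‖G‖ * cfFullCount A X x := by
  obtain ⟨N, hN⟩ := exists_pow_two_gt X
  have hN2 : X ^ 2 < (2 : ℝ) ^ (2 * N) := hN.trans_le (pow_le_pow_right₀ (by norm_num) (by omega))
  rw [cfEvenCountT_eq_sum Θ hA G hx hN, cfFullCount_eq_cfDynCount hA hx hN2, cfDynCount_eq_sum, Finset.mul_sum]
  -- compare the even terms with the corresponding terms of the full sum
  calc ∑ m ∈ Finset.range (N + 1), cfLenCountT A Θ G (2 * m) X x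
      ≤ ∑ m ∈ Finset.range (N + 1), ‖G‖ * cfLenCount A (2 * m) X x :=
        Finset.sum_le_sum fun m _ => cfLenCountT_le Θ hA G _ X hx
    _ = ∑ n ∈ (Finset.range (N + 1)).image (fun m => 2 * m), ‖G‖ * cfLenCount A n X x := by
        rw [Finset.sum_image fun a _ b _ h => mul_left_cancel₀ two_ne_zero h]
    _ ≤ ∑ n ∈ Finset.range (2 * N + 1), ‖G‖ * cfLenCount A n X x := by
        refine Finset.sum_le_sum_of_subset_of_nonneg ?_ fun n _ _ => mul_nonneg (norm_nonneg G) (cfLenCount_nonneg n X x)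
        intro n hn
        rw [Finset.mem_image] at hn
        obtain ⟨m, hm, rfl⟩ := hn
        rw [Finset.mem_range] at hm ⊢
        omega

end Counts

/-! ### The Laplace transforms -/

section Laplace

variable (A) (hA : ∀ a ∈ A, 1 ≤ a) (h2 : 2 ≤ A.card) (Θ : CfThreshold)
include hA h2

/-- The weighted, threshold-modified word indicator as a set indicator in `u`. [folklore] -/
theorem cfWordIndicatorT_eq {n : ℕ} (w : Fin n → A) {x : ℝ} (hx : x ∈ Icc (0 : ℝ) 1) (g : ℝ) (s : ℂ) (u : ℝ) :
    ((g * (if cfDenom (cfMat fun i => (w i : ℕ)) x * Θ.Φ (cfMoeb (cfMat fun i => (w i : ℕ)) x) ≤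
        Real.exp (u / (2 * cfDimension A)) then (1 : ℝ) else 0) : ℝ) : ℂ) * Complex.exp (-s * u) =
      (g : ℂ) * (Set.Ici (2 * cfDimension A * Real.log (cfDenom (cfMat fun i => (w i : ℕ)) x *
        Θ.Φ (cfMoeb (cfMat fun i => (w i : ℕ)) x)))).indicator (fun u : ℝ => Complex.exp (-s * u)) u := by
  have hd : 0 < cfDenom (cfMat fun i => (w i : ℕ)) x * Θ.Φ (cfMoeb (cfMat fun i => (w i : ℕ)) x) :=
    mul_pos (cfDenom_cfMat_pos (one_le_coe_digit hA w) hx) (Θ.pos (cfMoeb_cfMat_mem (one_le_coe_digit hA w) hx))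
  by_cases h : 2 * cfDimension A * Real.log (cfDenom (cfMat fun i => (w i : ℕ)) x *
      Θ.Φ (cfMoeb (cfMat fun i => (w i : ℕ)) x)) ≤ u
  · have h1 := (cfDenom_le_exp_iff A hA h2 hd u).2 h
    simp [Set.indicator, Set.mem_Ici, h, h1]
  · have h1 : ¬cfDenom (cfMat fun i => (w i : ℕ)) x * Θ.Φ (cfMoeb (cfMat fun i => (w i : ℕ)) x) ≤
        Real.exp (u / (2 * cfDimension A)) := fun h' => h ((cfDenom_le_exp_iff A hA h2 hd u).1 h')
    simp [Set.indicator, Set.mem_Ici, h, h1]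

/-- The threshold-modified integrand as a finite sum of indicators. [folklore] -/
theorem cfLenCountT_mul_cexp_eq (G : CfLip) (n : ℕ) (x : Icc (0 : ℝ) 1) (s : ℂ) (u : ℝ) :
    (cfLenCountT A Θ G n (Real.exp (u / (2 * cfDimension A))) x : ℂ) * Complex.exp (-s * u) =
      ∑ w : Fin n → A, ((G.extend (cfMoeb (cfMat fun i => (w i : ℕ)) x)).re : ℂ) *
        (Set.Ici (2 * cfDimension A * Real.log (cfDenom (cfMat fun i => (w i : ℕ)) x *
          Θ.Φ (cfMoeb (cfMat fun i => (w i : ℕ)) x)))).indicator (fun u : ℝ => Complex.exp (-s * u)) u := by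
  rw [cfLenCountT, Complex.ofReal_sum, Finset.sum_mul]
  exact Finset.sum_congr rfl fun w _ => cfWordIndicatorT_eq A hA h2 Θ w x.2 _ s u

/-- The test functions `G_s = G · Φ^{-2δ s}`. [folklore] -/
def cfGfam (G : CfLip) (s : ℂ) : CfLip := Θ.cfPowFam G (2 * cfDimension A) s

omit hA h2 in
/-- `e^{-s·2δ log(d Φ)} = wt_{δs}(M_w, x) · Φ^{-2δs}`. [folklore] -/
theorem cexp_neg_mul_log_mul_eq (s : ℂ) {d φ : ℝ} (hd : 0 < d) (hφ : 0 < φ) :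
    Complex.exp (-s * ((2 * cfDimension A * Real.log (d * φ) : ℝ) : ℂ)) =
      Complex.exp (-(2 * ((cfDimension A : ℂ) * s) * (Real.log d : ℂ))) *
        Complex.exp (-(((2 * cfDimension A : ℝ) : ℂ) * s * (Real.log φ : ℂ))) := by
  rw [← Complex.exp_add, Real.log_mul hd.ne' hφ.ne']
  congr 1
  push_cast
  ring

/-- **Laplace transform of the threshold-modified length count:** for `Re s > 0` and `G` real on `[0,1]`,
`∫_0^∞ N_n(e^{u/(2δ)}, x; G, Φ) e^{-su} du = s^{-1} (L_{δs}ⁿ G_s)(x)` with `G_s = G Φ^{-2δs}`.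
[cite: MageeOhWinter2019, §3.1 eq. (3.5)] -/
theorem integral_cfLenCountT {G : CfLip} (hGre : ∀ y : Icc (0 : ℝ) 1, (((G y).re : ℝ) : ℂ) = G y) (n : ℕ)
    (x : Icc (0 : ℝ) 1) {s : ℂ} (hs : 0 < s.re) :
    ∫ u in Set.Ioi (0 : ℝ), (cfLenCountT A Θ G n (Real.exp (u / (2 * cfDimension A))) x : ℂ) * Complex.exp (-s * u) =
      ((cfLOp A hA ((cfDimension A : ℂ) * s) ^ n) (cfGfam A Θ G s) x) / s := by
  simp_rw [cfLenCountT_mul_cexp_eq A hA h2 Θ G n x s]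
  rw [integral_finsetSum _ fun w _ => (integrableOn_indicator_exp _ hs).const_mul _, cfLOp_pow_apply_eq_sum,
    Finset.sum_div]
  refine Finset.sum_congr rfl fun w _ => ?_
  have hw1 := one_le_coe_digit hA w
  have hd := cfDenom_cfMat_pos hw1 x.2
  have hmem := cfMoeb_cfMat_mem hw1 x.2
  have hφ := Θ.pos hmem
  have hq1 : (1 : ℝ) ≤ cfDenom (cfMat fun i => (w i : ℕ)) x :=
    (by exact_mod_cast one_le_cfQ hw1 : (1 : ℝ) ≤ (cfQ fun i => (w i : ℕ) : ℝ)).trans (cfDenom_cfMat_mem hw1 x.2).1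
  have ht : 0 ≤ 2 * cfDimension A * Real.log (cfDenom (cfMat fun i => (w i : ℕ)) x *
      Θ.Φ (cfMoeb (cfMat fun i => (w i : ℕ)) x)) :=
    mul_nonneg (by linarith [cfDimension_pos hA h2]) (Real.log_nonneg (one_le_mul_of_one_le_of_one_le hq1 (Θ.one_le _ hmem)))
  rw [integral_const_mul, integral_indicator_exp ht hs, cexp_neg_mul_log_mul_eq A s hd hφ, ← cfWt,
    CfLip.extend_of_mem _ hmem, CfLip.extend_of_mem _ hmem, hGre, cfGfam, CfThreshold.cfPowFam_apply]
  push_cast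
  ring

/-- The integrand of `integral_cfLenCountT` is integrable. [folklore] -/
theorem integrable_cfLenCountT (G : CfLip) (n : ℕ) (x : Icc (0 : ℝ) 1) {s : ℂ} (hs : 0 < s.re) :
    IntegrableOn (fun u : ℝ => (cfLenCountT A Θ G n (Real.exp (u / (2 * cfDimension A))) x : ℂ) * Complex.exp (-s * u))
      (Set.Ioi 0) := by
  have hterm : (fun u : ℝ => (cfLenCountT A Θ G n (Real.exp (u / (2 * cfDimension A))) x : ℂ) * Complex.exp (-s * u)) =
      fun u => ∑ w : Fin n → A, ((G.extend (cfMoeb (cfMat fun i => (w i : ℕ)) x)).re : ℂ) *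
        (Set.Ici (2 * cfDimension A * Real.log (cfDenom (cfMat fun i => (w i : ℕ)) x *
          Θ.Φ (cfMoeb (cfMat fun i => (w i : ℕ)) x)))).indicator (fun u : ℝ => Complex.exp (-s * u)) u :=
    funext fun u => cfLenCountT_mul_cexp_eq A hA h2 Θ G n x s u
  rw [hterm]
  exact integrable_finsetSum _ fun w _ => (integrableOn_indicator_exp _ hs).const_mul _

omit hA h2 in
/-- The norm of the integrand (for `G ≥ 0`). [folklore] -/
theorem norm_cfLenCountT_mul_cexp {G : CfLip} (hG0 : ∀ y : Icc (0 : ℝ) 1, 0 ≤ (G y).re) (n : ℕ) (X : ℝ) (x : ℝ)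
    (s : ℂ) (u : ℝ) :
    ‖(cfLenCountT A Θ G n X x : ℂ) * Complex.exp (-s * u)‖ = cfLenCountT A Θ G n X x * Real.exp (-s.re * u) := by
  have hre : (-s * (u : ℂ)).re = -s.re * u := by
    simp [Complex.mul_re]
  rw [norm_mul, Complex.norm_real, Real.norm_of_nonneg (cfLenCountT_nonneg Θ hG0 n X x), Complex.norm_exp, hre]

/-- The `L¹` norms of the terms (`G ≥ 0`): `≤ ‖G‖ σ^{-1} 4^{δσ} λ_{δσ}ⁿ`. [folklore] -/
theorem integral_norm_cfLenCountT_le {G : CfLip} (hG0 : ∀ y : Icc (0 : ℝ) 1, 0 ≤ (G y).re) (n : ℕ)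
    (x : Icc (0 : ℝ) 1) {s : ℂ} (hs : 0 < s.re) :
    ∫ u in Set.Ioi (0 : ℝ), ‖(cfLenCountT A Θ G n (Real.exp (u / (2 * cfDimension A))) x : ℂ) * Complex.exp (-s * u)‖ ≤
      ‖G‖ * ((4 : ℝ) ^ (cfDimension A * s.re) * cfEig A (cfDimension A * s.re) ^ n / s.re) := by
  have hi1 : Integrable (fun u : ℝ => ‖(cfLenCountT A Θ G n (Real.exp (u / (2 * cfDimension A))) x : ℂ) *
      Complex.exp (-s * u)‖) (volume.restrict (Set.Ioi 0)) := (integrable_cfLenCountT A hA h2 Θ G n x hs).norm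
  have hi2 : Integrable (fun u : ℝ => ‖G‖ * ‖(cfLenCount A n (Real.exp (u / (2 * cfDimension A))) x : ℂ) *
      Complex.exp (-s * u)‖) (volume.restrict (Set.Ioi 0)) := by
    have h := (integrable_cfLenCountW A hA h2 (CfLip.const 1) n x hs).norm.const_mul ‖G‖
    simp_rw [cfLenCountW_const_one] at h
    exact h
  calc ∫ u in Set.Ioi (0 : ℝ), ‖(cfLenCountT A Θ G n (Real.exp (u / (2 * cfDimension A))) x : ℂ) * Complex.exp (-s * u)‖
      ≤ ∫ u in Set.Ioi (0 : ℝ), ‖G‖ * ‖(cfLenCount A n (Real.exp (u / (2 * cfDimension A))) x : ℂ) * Complex.exp (-s * u)‖ := by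
        refine integral_mono hi1 hi2 fun u => ?_
        show _ ≤ _
        rw [norm_cfLenCountT_mul_cexp A Θ hG0, norm_cfLenCount_mul_cexp, ← mul_assoc]
        exact mul_le_mul_of_nonneg_right (cfLenCountT_le Θ hA G n _ x.2) (Real.exp_pos _).le
    _ = ‖G‖ * ∫ u in Set.Ioi (0 : ℝ), ‖(cfLenCount A n (Real.exp (u / (2 * cfDimension A))) x : ℂ) * Complex.exp (-s * u)‖ :=
        integral_const_mul _ _
    _ ≤ _ := mul_le_mul_of_nonneg_left (integral_norm_cfLenCount_le A hA h2 n x hs) (norm_nonneg G)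

/-! ### The even resolvent `Σ_m L^{2m} = ½ (1 - L)^{-1} + ½ (1 + L)^{-1}` -/

/-- **`Σ_m (L_s^{2m} G)(x) = ½ ((1 - L_s)^{-1} G)(x) + ½ ((1 + L_s)^{-1} G)(x)`** for `Re s > δ`.
[cite: MageeOhWinter2019, §3.1] -/
theorem tsum_cfLOp_even_pow_apply {s : ℂ} (hs : cfDimension A < s.re) (G : CfLip) (x : Icc (0 : ℝ) 1) :
    ∑' m, (cfLOp A hA s ^ (2 * m)) G x =
      (1 / 2 : ℂ) * (Ring.inverse (1 - cfLOp A hA s) G x + Ring.inverse (1 + cfLOp A hA s) G x) := by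
  set L := cfLOp A hA s with hL
  have hsumN : Summable fun n => ‖L ^ n‖ := summable_norm_cfLOp_pow A hA h2 hs
  have hsum : Summable fun n => L ^ n := hsumN.of_norm
  have hsumNeg : Summable fun n => ‖(-L) ^ n‖ := hsumN.congr fun n => (norm_neg_pow' L n).symm
  have hsumNeg' : Summable fun n => (-L) ^ n := hsumNeg.of_norm
  have hU : Ring.inverse (1 - L) = ∑' n, L ^ n := inverse_one_sub_eq_tsum hsumN
  have hU' : Ring.inverse (1 + L) = ∑' n, (-L) ^ n := by
    have h := inverse_one_sub_eq_tsum hsumNeg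
    rwa [sub_neg_eq_add] at h
  -- even/odd splitting of `Σ (Lⁿ + (-L)ⁿ)`
  have hE : Summable fun m => L ^ (2 * m) :=
    hsum.comp_injective (fun a b h => mul_left_cancel₀ two_ne_zero h)
  have heven : ∀ m, L ^ (2 * m) + (-L) ^ (2 * m) = (2 : ℂ) • L ^ (2 * m) := fun m => by
    rw [Even.neg_pow ⟨m, by ring⟩, two_smul]
  have hodd : ∀ m, L ^ (2 * m + 1) + (-L) ^ (2 * m + 1) = 0 := fun m => by
    rw [Odd.neg_pow ⟨m, rfl⟩, add_neg_cancel]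
  have hsplit := tsum_even_add_odd (f := fun n => L ^ n + (-L) ^ n)
    (by simp_rw [heven]; exact hE.const_smul _) (by simp_rw [hodd]; exact summable_zero)
  simp_rw [heven, hodd, tsum_zero, add_zero] at hsplit
  rw [hsum.tsum_add hsumNeg', tsum_const_smul'' (2 : ℂ)] at hsplit
  -- evaluate at `G`, `x`
  have hΦsum := ((CfLip.eval x).comp (ContinuousLinearMap.apply ℂ CfLip G)).map_tsum hE
  simp only [ContinuousLinearMap.coe_comp, Function.comp_apply, ContinuousLinearMap.apply_apply,
    CfLip.eval_apply] at hΦsum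
  rw [← hΦsum, hU, hU']
  have h2 : (2 : ℂ) • ∑' m, L ^ (2 * m) = ∑' n, L ^ n + ∑' n, (-L) ^ n := hsplit
  have h3 : ∑' m, L ^ (2 * m) = (1 / 2 : ℂ) • (∑' n, L ^ n + ∑' n, (-L) ^ n) := by
    rw [← h2, smul_smul]; norm_num
  rw [h3]
  rfl

/-- `λ`-summability of the even terms' `L¹` norms. [folklore] -/
theorem summable_even_bound {σ : ℝ} (hσ : 1 < σ) (C : ℝ) :
    Summable fun m : ℕ => C * cfEig A (cfDimension A * σ) ^ (2 * m) := by
  have hl0 := (cfEig_pos (A := A) (cfDimension A * σ)).le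
  have hlt := cfEig_delta_mul_lt_one A hA h2 hσ
  exact ((summable_geometric_of_lt_one hl0 hlt).comp_injective
    (fun a b h => mul_left_cancel₀ two_ne_zero h)).mul_left C

/-- **The Laplace transform of the even count:** for `Re s > 1`, `G ≥ 0` real,
`∫_0^∞ N_even(e^{u/2δ}, x; G, Φ) e^{-su} du = ½ s^{-1} F_{G_s,x}(δs) + ½ s^{-1} ((1 + L_{δs})^{-1} G_s)(x)`.
[cite: MageeOhWinter2019, §3.1] -/
theorem cfEvenLaplace_eq {G : CfLip} (hGre : ∀ y : Icc (0 : ℝ) 1, (((G y).re : ℝ) : ℂ) = G y)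
    (hG0 : ∀ y : Icc (0 : ℝ) 1, 0 ≤ (G y).re) (x : Icc (0 : ℝ) 1) {s : ℂ} (hs : 1 < s.re) :
    ∫ u in Set.Ioi (0 : ℝ), (cfEvenCountT A Θ G (Real.exp (u / (2 * cfDimension A))) x : ℂ) * Complex.exp (-s * u) =
      ((1 / 2 : ℝ) : ℂ) * cfResFun A hA (cfGfam A Θ G s) x ((cfDimension A : ℂ) * s) / s +
        (1 / 2 : ℂ) * (Ring.inverse (1 + cfLOp A hA ((cfDimension A : ℂ) * s)) (cfGfam A Θ G s) x) / s := by
  have hs0 : 0 < s.re := by linarith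
  have hδ := cfDimension_pos hA h2
  set f : ℕ → ℝ → ℂ := fun m u =>
    (cfLenCountT A Θ G (2 * m) (Real.exp (u / (2 * cfDimension A))) x : ℂ) * Complex.exp (-s * u) with hf
  have hpt : ∀ u : ℝ, (cfEvenCountT A Θ G (Real.exp (u / (2 * cfDimension A))) x : ℂ) * Complex.exp (-s * u) =
      ∑' m, f m u := by
    intro u
    rw [cfEvenCountT, Complex.ofReal_tsum, ← tsum_mul_right]
  simp_rw [hpt]
  have hint : ∀ m, Integrable (f m) (volume.restrict (Set.Ioi 0)) := fun m =>
    integrable_cfLenCountT A hA h2 Θ G (2 * m) x hs0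
  have hsum : Summable fun m => ∫ u, ‖f m u‖ ∂(volume.restrict (Set.Ioi 0)) := by
    refine Summable.of_nonneg_of_le (fun m => integral_nonneg fun u => norm_nonneg _)
      (fun m => integral_norm_cfLenCountT_le A hA h2 Θ hG0 (2 * m) x hs0) ?_
    have h := summable_even_bound A hA h2 hs (‖G‖ * ((4 : ℝ) ^ (cfDimension A * s.re) / s.re))
    refine h.congr fun m => ?_
    ring
  rw [← integral_tsum_of_summable_integral_norm hint hsum]
  have hterm : ∀ m, ∫ u, f m u ∂(volume.restrict (Set.Ioi 0)) =
      ((cfLOp A hA ((cfDimension A : ℂ) * s) ^ (2 * m)) (cfGfam A Θ G s) x) / s := fun m =>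
    integral_cfLenCountT A hA h2 Θ hGre (2 * m) x hs0
  simp_rw [hterm]
  have hlt : cfDimension A < ((cfDimension A : ℂ) * s).re := by
    rw [Complex.re_ofReal_mul]
    nlinarith
  rw [tsum_div_const, tsum_cfLOp_even_pow_apply A hA h2 hlt, cfResFun]
  push_cast
  ring

/-! ### The asymptotic -/

/-- **The renewal constant for even words with threshold `Φ`:**
`c_{G,Φ}(x) = ½ ν(G Φ^{-2δ}) h(x) / (δ κ)`. [cite: MageeOhWinter2019, Prop. 17] -/
def cfEvenConst (G : CfLip) (x : Icc (0 : ℝ) 1) : ℝ :=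
  1 / 2 * cfInt (cfNuδ A hA h2) (fun y => (G.extend y).re * Θ.Φ y ^ (-(2 * cfDimension A))) * cfHδ A hA h2 x /
    (cfDimension A * cfInt (cfNuδ A hA h2) (cfG A hA h2))

/-- `ν(G_1) = ∫ Re G · Φ^{-2δ} dν` (real). [folklore] -/
theorem cfNuL_cfGfam_one {G : CfLip} (hGre : ∀ y : Icc (0 : ℝ) 1, (((G y).re : ℝ) : ℂ) = G y) :
    cfNuL A hA h2 (cfGfam A Θ G 1) =
      ((cfInt (cfNuδ A hA h2) (fun y => (G.extend y).re * Θ.Φ y ^ (-(2 * cfDimension A))) : ℝ) : ℂ) := by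
  refine cfNuL_of_real A hA h2 (g := fun y => (G.extend y).re * Θ.Φ y ^ (-(2 * cfDimension A))) fun y => ?_
  rw [cfGfam, show (1 : ℂ) = ((1 : ℝ) : ℂ) from Complex.ofReal_one.symm, Θ.cfPowFam_ofReal hGre, CfLip.extend_coe, mul_one]

/-- **The renewal theorem for even words with a modified threshold** ([MageeOhWinter2019, Prop. 17],
main term, `q = 1`): for `G ≥ 0` real Lipschitz, `Φ ≥ 1` Lipschitz and `x ∈ [0,1]`,
`N_even(X, x; G, Φ) = Σ_{|w| even, denom(M_w,x) Φ(M_w x) ≤ X} G(M_w x) ~ ½ ν(G Φ^{-2δ}) c(x) X^{2δ}`,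
`c(x) = h(x)/(δ κ)`. [cite: MageeOhWinter2019, Prop. 17] -/
theorem cfEvenCountT_asymp {G : CfLip} (hGre : ∀ y : Icc (0 : ℝ) 1, (((G y).re : ℝ) : ℂ) = G y)
    (hG0 : ∀ y : Icc (0 : ℝ) 1, 0 ≤ (G y).re) (x : Icc (0 : ℝ) 1) :
    Tendsto (fun X : ℝ => cfEvenCountT A Θ G X x / X ^ (2 * cfDimension A)) atTop
      (𝓝 (cfEvenConst A hA h2 Θ G x)) := by
  have hδ := cfDimension_pos hA h2
  obtain ⟨K, hK, hb⟩ := cfFullCount_le hA h2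
  -- the counting function in the logarithmic variable
  set a : ℝ → ℝ := fun u => cfEvenCountT A Θ G (Real.exp (u / (2 * cfDimension A))) x with ha
  have hmono : Monotone a := fun u v huv =>
    cfEvenCountT_mono Θ hA hG0 x.2 (Real.exp_le_exp.2 (div_le_div_of_nonneg_right huv (by positivity)))
  have ha0 : ∀ u, 0 ≤ a u := fun u => cfEvenCountT_nonneg Θ hG0 _ _
  have hbound : ∀ u, a u ≤ ‖G‖ * K * (1 + Real.exp u) := by
    intro u
    have hX0 : 0 ≤ Real.exp (u / (2 * cfDimension A)) := (Real.exp_pos _).le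
    have h := hb x x.2 _ hX0
    have hpow : Real.exp (u / (2 * cfDimension A)) ^ (2 * cfDimension A) = Real.exp u := by
      rw [← Real.exp_mul, div_mul_cancel₀ _ (by positivity)]
    rw [hpow] at h
    calc a u ≤ ‖G‖ * cfFullCount A (Real.exp (u / (2 * cfDimension A))) x := cfEvenCountT_le_norm_mul Θ hA G x.2 _
      _ ≤ ‖G‖ * (K * (1 + Real.exp u)) := mul_le_mul_of_nonneg_left h (norm_nonneg G)
      _ = ‖G‖ * K * (1 + Real.exp u) := by ring
  -- the family `G_s` and the extra term
  have hGcont : ContinuousOn (cfGfam A Θ G) {s : ℂ | 1 ≤ s.re} := (Θ.continuous_cfPowFam G _).continuousOn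
  have hGdiff : DifferentiableAt ℂ (fun s => cfNuL A hA h2 (cfGfam A Θ G s)) 1 :=
    Θ.differentiableAt_cfNuL_cfPowFam hA h2 G _ 1
  set E : ℂ → ℂ := fun s =>
    (1 / 2 : ℂ) * (Ring.inverse (1 + cfLOp A hA ((cfDimension A : ℂ) * s)) (cfGfam A Θ G s) x) / s with hE
  have hEcont : ContinuousOn E {s : ℂ | 1 ≤ s.re} := by
    intro s₀ hs₀
    have hs₀re : 1 ≤ s₀.re := hs₀
    have hs₀0 : s₀ ≠ 0 := fun h => by rw [h, Complex.zero_re] at hs₀re; linarith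
    have hre : cfDimension A ≤ ((cfDimension A : ℂ) * s₀).re := by
      rw [Complex.re_ofReal_mul]; nlinarith
    have hR : ContinuousWithinAt (fun s => Ring.inverse (1 + cfLOp A hA ((cfDimension A : ℂ) * s))) {s : ℂ | 1 ≤ s.re} s₀ :=
      ((continuousAt_inverse_one_add_cfLOp A hA h2 hre).comp
        (continuous_const.mul continuous_id).continuousAt).continuousWithinAt
    have h := hR.clm_apply (hGcont s₀ hs₀)
    have h' := (CfLip.eval x).continuous.continuousAt.comp_continuousWithinAt h
    exact ((continuousWithinAt_const.mul h').div continuousWithinAt_id hs₀0)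
  have hLap : ∀ s : ℂ, 1 < s.re → ∫ u in Set.Ioi (0 : ℝ), (a u : ℂ) * Complex.exp (-s * u) =
      ((1 / 2 : ℝ) : ℂ) * cfResFun A hA (cfGfam A Θ G s) x ((cfDimension A : ℂ) * s) / s + E s :=
    fun s hs => cfEvenLaplace_eq A hA h2 Θ hGre hG0 x hs
  have hlim := tendsto_of_cfLaplace A hA h2 hmono ha0 (by positivity : 0 ≤ ‖G‖ * K) hbound hGcont hGdiff
    (cfNuL_cfGfam_one A hA h2 Θ hGre) (1 / 2) hEcont x hLap
  have h := tendsto_rpow_of_tendsto_exp A (N := fun X => cfEvenCountT A Θ G X x) hδ hlim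
  rw [cfEvenConst]
  exact h

end Laplace

end Literature.NumberTheory.Sieve
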